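import Summits.AtomisticToContinuum.FouriersLaw.Theses.OddSectorIrreversibility
import Summits.AtomisticToContinuum.FouriersLaw.Theses.SpatialCentreManifold
import Summits.AtomisticToContinuum.FouriersLaw.Theorems.BoundaryKubo.Negative.Reflection
import Summits.AtomisticToContinuum.FouriersLaw.Theorems.PuiseuxTransferLedgerFiniteResponseProfile
import Summits.AtomisticToContinuum.FouriersLaw.Theorems.TransferKernelPositivityContactIdentity
import Summits.AtomisticToContinuum.FouriersLaw.Theorems.OddSectorIrreversibilityBoundedResponseConvergesStubPositiveConductance
import Summits.AtomisticToContinuum.FouriersLaw.Theorems.OddSectorIrreversibilityBoundedResponseConvergesComonotoneGlue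
import Summits.AtomisticToContinuum.FouriersLaw.Theorems.OddSectorIrreversibilityBoundedResponseConvergesStubLayerBounded

/-!
# Crux `BoundedResponseConverges` (stmt-AtomisticToContinuum-9141), line `comonotone-local-resistance`:
# the composition as a theorem, and the line from `SpatialCentreManifold.LocalFourierLaw`

Lead c3. (1) `boundedResponseConverges_of_comonotone`: the three `N`-uniform statements of the line — S1 (inward
quasi-ordering of the local resistances on the hot half), S2 (length quasi-monotonicity at fixed depth), S3 (fixed-depth
boundedness), verbatim the registered stubs `stub_inwardOrdering / stub_lengthMonotone / stub_layerBounded` — imply the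
crux `OddSectorIrreversibility.BoundedResponseConverges` BY NAME, unconditionally: the planner's composition with its
three fixed-`N` inputs discharged by landed theorems (`finiteResponseProfile_proof` stmt-12011,
`transferKernelPositivity_contactIdentity_proof` stmt-12015, `positiveConductance_holds` stmt-11750), the reflection
antisymmetry `θ_N(N−1−i) = −θ_N(i)` (`responseProfile_reflect`, from the landed `isSteadyState_map_reflect`) and the
landed glue `Glue.exchange_of_limits_core`. (2) `stub_inwardOrdering_of_localFourierLaw`: S1 is a shadow of the sibling
crux `SpatialCentreManifold.LocalFourierLaw` (stmt-13406; slack `s_i = 4 Σ_{k ≥ i} a_k`), as S2, S3 are (landed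
`stub_lengthMonotone_of_summableLayers`, `stub_layerBounded_of_localFourierLaw`); the corollary stmt-13406 ⇒ stmt-9141
is drawn in the companion file `…ComonotoneFloor.lean`. No definitions; standard axioms.
-/

noncomputable section

namespace Summit.AtomisticToContinuum.FouriersLaw.Cruxes.BoundedResponseConverges.ComonotoneLocalResistance.Stubs

open MeasureTheory Filter Topology
open Literature.MathematicalPhysics.KineticTheory.HeatConduction
open Summit.AtomisticToContinuum.FouriersLaw.Theorems.BoundaryKubo.Negative.Reflection

/-! ### Fixed-`N` algebra: series law and reflection antisymmetry -/

/-- OHMIC SERIES LAW, abstract form: from the two contact identities `d = γ n (1/2 − θ₀)`,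
`d = γ n (θ₁ + 1/2)` (`n = N − 1`), the bath-to-bath resistance is `n/d = 2/γ + (θ₀ − θ₁)·(n/d)`.
(Ideator 3's `ledger_abstract`.) [folklore] -/
theorem series_law_of_contact (γ : ℝ) (hγ : γ ≠ 0) (n d θ₀ θ₁ : ℝ) (hn : n ≠ 0) (hd : d ≠ 0)
    (h0 : d = γ * n * (1 / 2 - θ₀)) (h1 : d = γ * n * (θ₁ + 1 / 2)) :
    n / d = 2 / γ + (θ₀ - θ₁) * (n / d) := by
  have hsum : 2 * d = γ * n * (1 + θ₁ - θ₀) := by linear_combination h0 + h1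
  have hγn : γ * n ≠ 0 := mul_ne_zero hγ hn
  have e2 : θ₀ - θ₁ = 1 - 2 * d / (γ * n) := by
    field_simp
    linear_combination hsum
  rw [e2]
  field_simp
  ring

/-- **Reflection antisymmetry of the kinetic-temperature response profile (PROVED).** Under
weak-NESS uniqueness, along a steady family, `θ_N(N−1−i) = −θ_N(i)`: the site reflection maps the
steady state at `(T_L, T_R)` to the steady state at `(T_R, T_L)` (`isSteadyState_map_reflect`,
landed), so `⟨p²_{N−1−i}⟩_{T+δ/2,T−δ/2} = ⟨p_i²⟩_{T−δ/2,T+δ/2}` and the difference quotient at the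
reflected site is minus the quotient at `i` evaluated at `−δ`. [folklore] -/
theorem responseProfile_reflect {ω₂ lam β γ : ℝ}
    (hU : ∀ (N : ℕ) (T_L T_R : ℝ), 0 < T_L → 0 < T_R → ∀ μ' ν' : Measure (PhaseSpace N),
      (pinnedChain ω₂ lam β γ).IsSteadyState N T_L T_R μ' →
        (pinnedChain ω₂ lam β γ).IsSteadyState N T_L T_R ν' → μ' = ν')
    {μ : (M : ℕ) → ℝ → ℝ → Measure (PhaseSpace M)}
    (hμ : ∀ (N : ℕ) (T_L T_R : ℝ), 0 < T_L → 0 < T_R →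
      (pinnedChain ω₂ lam β γ).IsSteadyState N T_L T_R (μ N T_L T_R))
    {T : ℝ} (hT : 0 < T) {N : ℕ} {θ : ℕ → ℝ}
    (hθ : ∀ i : Fin N, Tendsto (fun δ : ℝ =>
      ((∫ x, (x.2 i) ^ 2 ∂(μ N (T + δ / 2) (T - δ / 2))) - ∫ x, (x.2 i) ^ 2 ∂(μ N T T)) / δ)
      (𝓝[≠] 0) (𝓝 (θ i)))
    (i : ℕ) (hi : i < N) : θ (N - 1 - i) = -θ i := by
  -- second moments along the family
  set m : Fin N → ℝ → ℝ → ℝ := fun k a b => ∫ x, (x.2 k) ^ 2 ∂(μ N a b) with hm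
  have hswap : ∀ (k : Fin N) (a b : ℝ), 0 < a → 0 < b → m k b a = m (Fin.rev k) a b := by
    intro k a b ha hb
    have h1 := isSteadyState_map_reflect _ (pinnedChain_V_even ω₂ lam β γ) (hμ N a b ha hb)
    have h2 : μ N b a = (μ N a b).map (reflectCLE N) :=
      hU N b a hb ha _ _ (hμ N b a hb ha) h1
    simp only [hm]
    rw [h2, measurableEmbedding_reflect.integral_map]
    simp only [reflectCLE_snd]
  have hθ' : ∀ k : Fin N, Tendsto (fun δ : ℝ => (m k (T + δ / 2) (T - δ / 2) - m k T T) / δ)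
      (𝓝[≠] 0) (𝓝 (θ k)) := fun k => hθ k
  have hjval : ((Fin.rev (⟨i, hi⟩ : Fin N) : Fin N) : ℕ) = N - 1 - i := by
    rw [Fin.val_rev]
    show N - (i + 1) = N - 1 - i
    omega
  -- negation on the punctured neighbourhood
  have hneg : Tendsto (fun δ : ℝ => -δ) (𝓝[≠] (0 : ℝ)) (𝓝[≠] (0 : ℝ)) := by
    rw [tendsto_nhdsWithin_iff]
    constructor
    · have h : Tendsto (fun δ : ℝ => -δ) (𝓝 (0 : ℝ)) (𝓝 (0 : ℝ)) := by
        simpa using (continuous_neg.tendsto (0 : ℝ))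
      exact h.mono_left nhdsWithin_le_nhds
    · filter_upwards [self_mem_nhdsWithin] with δ hδ
      simpa using hδ
  have h1 : Tendsto (fun δ : ℝ => (m ⟨i, hi⟩ (T + -δ / 2) (T - -δ / 2) - m ⟨i, hi⟩ T T) / -δ)
      (𝓝[≠] 0) (𝓝 (θ ((⟨i, hi⟩ : Fin N) : ℕ))) := (hθ' ⟨i, hi⟩).comp hneg
  have h2 := h1.neg
  have h3 : (fun δ : ℝ => -((m ⟨i, hi⟩ (T + -δ / 2) (T - -δ / 2) - m ⟨i, hi⟩ T T) / -δ))
      =ᶠ[𝓝[≠] (0 : ℝ)]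
      (fun δ : ℝ => (m (Fin.rev ⟨i, hi⟩) (T + δ / 2) (T - δ / 2) - m (Fin.rev ⟨i, hi⟩) T T) / δ) := by
    have hI : Set.Ioo (-(2 * T)) (2 * T) ∈ 𝓝[≠] (0 : ℝ) :=
      nhdsWithin_le_nhds (Ioo_mem_nhds (by linarith) (by linarith))
    filter_upwards [hI] with δ hδ
    have ha : 0 < T - δ / 2 := by linarith [hδ.2]
    have hb : 0 < T + δ / 2 := by linarith [hδ.1]
    have e1 : m (Fin.rev ⟨i, hi⟩) (T + δ / 2) (T - δ / 2) = m ⟨i, hi⟩ (T - δ / 2) (T + δ / 2) := by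
      rw [hswap (Fin.rev ⟨i, hi⟩) (T - δ / 2) (T + δ / 2) ha hb, Fin.rev_rev]
    have e2 : m (Fin.rev ⟨i, hi⟩) T T = m ⟨i, hi⟩ T T := by
      rw [hswap (Fin.rev ⟨i, hi⟩) T T hT hT, Fin.rev_rev]
    rw [e1, e2, show T + -δ / 2 = T - δ / 2 by ring, show T - -δ / 2 = T + δ / 2 by ring,
      div_neg, neg_neg]
  have h4 : Tendsto (fun δ : ℝ =>
      (m (Fin.rev ⟨i, hi⟩) (T + δ / 2) (T - δ / 2) - m (Fin.rev ⟨i, hi⟩) T T) / δ)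
      (𝓝[≠] 0) (𝓝 (-θ ((⟨i, hi⟩ : Fin N) : ℕ))) := h2.congr' h3
  have h5 : θ ((Fin.rev (⟨i, hi⟩ : Fin N) : Fin N) : ℕ) = -θ ((⟨i, hi⟩ : Fin N) : ℕ) :=
    tendsto_nhds_unique (hθ' (Fin.rev ⟨i, hi⟩)) h4
  rw [hjval] at h5
  exact h5

/-! ### The composition: S1 ∧ S2 ∧ S3 ⇒ crux, BY NAME -/

/-- **Line `comonotone-local-resistance`, composition (registered sub-goal `boundedResponseConverges_of_comonotone`).**
The three registered stubs S1 `stub_inwardOrdering`, S2 `stub_lengthMonotone`, S3 `stub_layerBounded` (hypotheses,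
verbatim) imply `OddSectorIrreversibility.BoundedResponseConverges`. Proof: choose the response profiles `θ_N`
(`finiteResponseProfile_proof`), positivity `D_N > 0` (`positiveConductance_holds`), the contact identities
(`transferKernelPositivity_contactIdentity_proof`) giving the series law `(N−1)/D_N = 2/γ + Σ_b r_b^{(N)}`, reflection
`r_b = r_{N−2−b}` (`responseProfile_reflect`), the crux's `BddAbove` giving `1/S ≤ 1/D_N`; then
`Glue.exchange_of_limits_core` yields `1/D_N → r∞ ≥ 1/S > 0`, i.e. `D_N → 1/r∞ > 0`. [folklore] -/
theorem boundedResponseConverges_of_comonotone :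
    (∀ ω₂ lam β γ : ℝ, 0 < ω₂ → 0 < lam → 0 < β → 0 < γ → (∀ (N : ℕ) (T_L T_R : ℝ), 0 < T_L → 0 < T_R → ∀ μ
    ν : Measure (PhaseSpace N), (pinnedChain ω₂ lam β γ).IsSteadyState N T_L T_R μ → (pinnedChain ω₂ lam β
    γ).IsSteadyState N T_L T_R ν → μ = ν) → ∀ μ : (N : ℕ) → ℝ → ℝ → Measure (PhaseSpace N), (∀ (N : ℕ) (T_L
    T_R : ℝ), 0 < T_L → 0 < T_R → (pinnedChain ω₂ lam β γ).IsSteadyState N T_L T_R (μ N T_L T_R)) → ∀ T : ℝ,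
    0 < T → ∃ N₀ i₀ : ℕ, ∃ s : ℕ → ℝ, Tendsto s atTop (𝓝 0) ∧ ∀ (N : ℕ) (θ : ℕ → ℝ) (d : ℝ), N₀ ≤ N → (∀ i :
    Fin N, Tendsto (fun δ : ℝ => ((∫ x, (x.2 i) ^ 2 ∂(μ N (T + δ / 2) (T - δ / 2))) - ∫ x, (x.2 i) ^ 2 ∂(μ N
    T T)) / δ) (𝓝[≠] 0) (𝓝 (θ i))) → Tendsto (fun δ : ℝ => (pinnedChain ω₂ lam β γ).totalCurrent (μ N (T + δ
    / 2) (T - δ / 2)) / δ) (𝓝[≠] 0) (𝓝 d) → 0 < d → ∀ i j : ℕ, i₀ ≤ i → i ≤ j → 2 * j + 2 ≤ N → (θ j - θ (j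
    + 1)) * (((N : ℝ) - 1) / d) ≤ (θ i - θ (i + 1)) * (((N : ℝ) - 1) / d) + s i) → (∀ ω₂ lam β γ : ℝ, 0 < ω₂
    → 0 < lam → 0 < β → 0 < γ → (∀ (N : ℕ) (T_L T_R : ℝ), 0 < T_L → 0 < T_R → ∀ μ ν : Measure (PhaseSpace
    N), (pinnedChain ω₂ lam β γ).IsSteadyState N T_L T_R μ → (pinnedChain ω₂ lam β γ).IsSteadyState N T_L
    T_R ν → μ = ν) → ∀ μ : (N : ℕ) → ℝ → ℝ → Measure (PhaseSpace N), (∀ (N : ℕ) (T_L T_R : ℝ), 0 < T_L → 0 <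
    T_R → (pinnedChain ω₂ lam β γ).IsSteadyState N T_L T_R (μ N T_L T_R)) → ∀ T : ℝ, 0 < T → ∃ N₀ i₁ : ℕ, ∃
    η : ℕ → ℝ, Tendsto η atTop (𝓝 0) ∧ ∀ (N N' : ℕ) (θ θ' : ℕ → ℝ) (d d' : ℝ), N₀ ≤ N → N ≤ N' → (∀ i : Fin
    N, Tendsto (fun δ : ℝ => ((∫ x, (x.2 i) ^ 2 ∂(μ N (T + δ / 2) (T - δ / 2))) - ∫ x, (x.2 i) ^ 2 ∂(μ N T
    T)) / δ) (𝓝[≠] 0) (𝓝 (θ i))) → (∀ i : Fin N', Tendsto (fun δ : ℝ => ((∫ x, (x.2 i) ^ 2 ∂(μ N' (T + δ /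
    2) (T - δ / 2))) - ∫ x, (x.2 i) ^ 2 ∂(μ N' T T)) / δ) (𝓝[≠] 0) (𝓝 (θ' i))) → Tendsto (fun δ : ℝ =>
    (pinnedChain ω₂ lam β γ).totalCurrent (μ N (T + δ / 2) (T - δ / 2)) / δ) (𝓝[≠] 0) (𝓝 d) → Tendsto (fun δ
    : ℝ => (pinnedChain ω₂ lam β γ).totalCurrent (μ N' (T + δ / 2) (T - δ / 2)) / δ) (𝓝[≠] 0) (𝓝 d') → 0 < d
    → 0 < d' → ∀ i : ℕ, i₁ ≤ i → 2 * i + 2 ≤ N → (θ' i - θ' (i + 1)) * (((N' : ℝ) - 1) / d') ≤ (θ i - θ (i +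
    1)) * (((N : ℝ) - 1) / d) + η i) → (∀ ω₂ lam β γ : ℝ, 0 < ω₂ → 0 < lam → 0 < β → 0 < γ → (∀ (N : ℕ) (T_L
    T_R : ℝ), 0 < T_L → 0 < T_R → ∀ μ ν : Measure (PhaseSpace N), (pinnedChain ω₂ lam β γ).IsSteadyState N
    T_L T_R μ → (pinnedChain ω₂ lam β γ).IsSteadyState N T_L T_R ν → μ = ν) → ∀ μ : (N : ℕ) → ℝ → ℝ →
    Measure (PhaseSpace N), (∀ (N : ℕ) (T_L T_R : ℝ), 0 < T_L → 0 < T_R → (pinnedChain ω₂ lam β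
    γ).IsSteadyState N T_L T_R (μ N T_L T_R)) → ∀ T : ℝ, 0 < T → ∀ j : ℕ, ∃ B : ℝ, ∃ N₀ : ℕ, ∀ (N : ℕ) (θ :
    ℕ → ℝ) (d : ℝ), N₀ ≤ N → 2 * j + 2 ≤ N → (∀ i : Fin N, Tendsto (fun δ : ℝ => ((∫ x, (x.2 i) ^ 2 ∂(μ N (T
    + δ / 2) (T - δ / 2))) - ∫ x, (x.2 i) ^ 2 ∂(μ N T T)) / δ) (𝓝[≠] 0) (𝓝 (θ i))) → Tendsto (fun δ : ℝ =>
    (pinnedChain ω₂ lam β γ).totalCurrent (μ N (T + δ / 2) (T - δ / 2)) / δ) (𝓝[≠] 0) (𝓝 d) → 0 < d → |(θ j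
    - θ (j + 1)) * (((N : ℝ) - 1) / d)| ≤ B) →
    Summit.AtomisticToContinuum.FouriersLaw.Theses.OddSectorIrreversibility.BoundedResponseConverges := by
  intro h1 h2 h3 ω₂ lam β γ hω hl hβ hγ hU μ hμ T hT D hD hB
  -- the response profiles θ N : ℕ → ℝ
  have hprof := fun N i =>
    Theorems.PuiseuxTransferLedgerFiniteResponseProfile.finiteResponseProfile_proof
      ω₂ lam β γ hω hl hβ hγ hU μ hμ T hT N i
  choose θF hθF using hprof
  set θ : ℕ → ℕ → ℝ := fun N i => if h : i < N then θF N ⟨i, h⟩ else 0 with hθdef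
  have hθ : ∀ (N : ℕ) (i : Fin N), Tendsto (fun δ : ℝ =>
      ((∫ x, (x.2 i) ^ 2 ∂(μ N (T + δ / 2) (T - δ / 2))) - ∫ x, (x.2 i) ^ 2 ∂(μ N T T)) / δ)
      (𝓝[≠] 0) (𝓝 (θ N i)) := by
    intro N i
    have e : θ N i = θF N i := by
      show (if h : (i : ℕ) < N then θF N ⟨i, h⟩ else 0) = θF N i
      rw [dif_pos i.isLt]
    rw [e]
    exact hθF N i
  -- positivity of the response and the contact identities
  have hpos : ∀ N, 2 ≤ N → 0 < D N :=
    TwoScaleGluingLogRigidity.Stubs.positiveConductance_holds ω₂ lam β γ hω hl hβ hγ hU μ hμ T hT D hD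
  have hci : ∀ (N : ℕ), 2 ≤ N →
      D N = γ * ((N : ℝ) - 1) * (1 / 2 - θ N 0) ∧ D N = γ * ((N : ℝ) - 1) * (θ N (N - 1) + 1 / 2) := by
    intro N hN
    exact Theorems.transferKernelPositivity_contactIdentity_proof ω₂ lam β γ hω hl hβ hγ hU μ hμ T hT N hN
      (θ N 0) (θ N (N - 1)) (D N)
      (hθ N ⟨0, by omega⟩) (hθ N ⟨N - 1, by omega⟩) (hD N)
  -- reflection antisymmetry
  have hanti : ∀ (N i : ℕ), i < N → θ N (N - 1 - i) = -θ N i :=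
    fun N i hi => responseProfile_reflect hU hμ hT (hθ N) i hi
  -- local resistances and the bath-to-bath resistance
  set r : ℕ → ℕ → ℝ := fun N b => (θ N b - θ N (b + 1)) * (((N : ℝ) - 1) / D N) with hrdef
  set R : ℕ → ℝ := fun N => ((N : ℝ) - 1) / D N with hRdef
  have hledger : ∀ N, 2 ≤ N → R N = 2 / γ + ∑ b ∈ Finset.range (N - 1), r N b := by
    intro N hN
    obtain ⟨h0, h1⟩ := hci N hN
    have hDpos := hpos N hN
    have hN1 : (0 : ℝ) < (N : ℝ) - 1 := by
      have : (2 : ℝ) ≤ (N : ℝ) := by exact_mod_cast hN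
      linarith
    have htel : ∑ b ∈ Finset.range (N - 1), (θ N b - θ N (b + 1)) = θ N 0 - θ N (N - 1) :=
      Finset.sum_range_sub' (fun b => θ N b) (N - 1)
    show ((N : ℝ) - 1) / D N =
      2 / γ + ∑ b ∈ Finset.range (N - 1), (θ N b - θ N (b + 1)) * (((N : ℝ) - 1) / D N)
    rw [← Finset.sum_mul, htel]
    exact series_law_of_contact γ hγ.ne' ((N : ℝ) - 1) (D N) (θ N 0) (θ N (N - 1)) hN1.ne' hDpos.ne' h0 h1
  have hrefl : ∀ N b, 2 ≤ N → b + 2 ≤ N → r N b = r N (N - 2 - b) := by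
    intro N b hN hb
    have ha := hanti N (b + 1) (by omega)
    have hb' := hanti N b (by omega)
    have e1 : N - 1 - (b + 1) = N - 2 - b := by omega
    have e2 : N - 2 - b + 1 = N - 1 - b := by omega
    show (θ N b - θ N (b + 1)) * (((N : ℝ) - 1) / D N) =
      (θ N (N - 2 - b) - θ N (N - 2 - b + 1)) * (((N : ℝ) - 1) / D N)
    rw [e2, ← e1, ha, hb']
    ring
  -- bounded response: 1/S ≤ R N/(N-1)
  obtain ⟨S₀, hS₀⟩ := hB
  set S : ℝ := max S₀ 1 with hSdef
  have hSpos : 0 < S := lt_of_lt_of_le one_pos (le_max_right _ _)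
  have hbound : ∀ N, 2 ≤ N → 1 / S ≤ R N / ((N : ℝ) - 1) := by
    intro N hN
    have hDpos := hpos N hN
    have hDle : D N ≤ S := le_trans (le_trans (le_abs_self _) (hS₀ ⟨N, rfl⟩)) (le_max_left _ _)
    have hN1 : (0 : ℝ) < (N : ℝ) - 1 := by
      have : (2 : ℝ) ≤ (N : ℝ) := by exact_mod_cast hN
      linarith
    have e : R N / ((N : ℝ) - 1) = 1 / D N := by
      show ((N : ℝ) - 1) / D N / ((N : ℝ) - 1) = 1 / D N
      field_simp
    rw [e]
    exact one_div_le_one_div_of_le hDpos hDle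
  -- the stubs
  obtain ⟨N₁, i₀, s, hs, hS1⟩ := h1 ω₂ lam β γ hω hl hβ hγ hU μ hμ T hT
  obtain ⟨N₂, i₁, η, hη, hS2⟩ := h2 ω₂ lam β γ hω hl hβ hγ hU μ hμ T hT
  have hS3 := h3 ω₂ lam β γ hω hl hβ hγ hU μ hμ T hT
  choose Bf N₀f hBf using hS3
  -- thresholds
  set Nst : ℕ := N₁ + N₂ + 2 with hNst
  set ι : ℕ := i₀ + i₁ with hι
  have hC1 : ∀ N i j, Nst ≤ N → ι ≤ i → i ≤ j → 2 * j + 2 ≤ N → r N j ≤ r N i + s i := by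
    intro N i j hN hi hij hj
    exact hS1 N (θ N) (D N) (by omega) (hθ N) (hD N) (hpos N (by omega)) i j (by omega) hij hj
  have hC3 : ∀ N N' i, Nst ≤ N → N ≤ N' → ι ≤ i → 2 * i + 2 ≤ N → r N' i ≤ r N i + η i := by
    intro N N' i hN hNN' hi hiN
    exact hS2 N N' (θ N) (θ N') (D N) (D N') (by omega) hNN' (hθ N) (hθ N') (hD N) (hD N')
      (hpos N (by omega)) (hpos N' (by omega)) i (by omega) hiN
  have hS3' : ∀ j, ∃ B' : ℝ, ∀ N, (Nst ≤ N ∧ 2 * j + 2 ≤ N) → |r N j| ≤ B' := by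
    intro j
    refine Glue.abs_le_of_tail (fun N => r N j) (N₀f j) (Bf j) (fun N => Nst ≤ N ∧ 2 * j + 2 ≤ N) ?_
    intro N hK hP
    exact hBf j N (θ N) (D N) hK hP.2 (hθ N) (hD N) (hpos N (by omega))
  choose B hBd using hS3'
  -- exchange of limits
  obtain ⟨rinf, hrinf, hRT⟩ := Glue.exchange_of_limits_core γ S R r Nst ι s η B hγ (by omega) hs hη
    (fun N hN => hledger N (by omega)) (fun N hN => hbound N (by omega))
    (fun N b hN hb => hrefl N b (by omega) hb) hC1 hC3 (fun N j hN hj => hBd j N ⟨hN, hj⟩)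
  -- invert
  have hrpos : 0 < rinf := lt_of_lt_of_le (div_pos one_pos hSpos) hrinf
  refine ⟨rinf⁻¹, inv_pos.mpr hrpos, ?_⟩
  have hinv := hRT.inv₀ (ne_of_gt hrpos)
  refine hinv.congr' ?_
  refine Filter.eventually_atTop.mpr ⟨2, fun N hN => ?_⟩
  have hDpos := hpos N hN
  have hN1 : (0 : ℝ) < (N : ℝ) - 1 := by
    have : (2 : ℝ) ≤ (N : ℝ) := by exact_mod_cast hN
    linarith
  show (((N : ℝ) - 1) / D N / ((N : ℝ) - 1))⁻¹ = D N
  field_simp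

/-! ### S1 is a shadow of `SpatialCentreManifold.LocalFourierLaw` (stmt-AtomisticToContinuum-13406) -/

/-- **S1 ⇐ local Fourier law with summable contact layers.** If `SpatialCentreManifold.LocalFourierLaw` holds
(`|τ(b+1) − τ(b) + r ι_N| ≤ ι_N (a_b + a_{N−2−b})`, `a ≥ 0` summable, `D_N = (N−1)ι_N`), then every local resistance
satisfies `|r_b^{(N)} − r| ≤ a_b + a_{N−2−b}`, so for `i ≤ j ≤ (N−2)/2` all four indices `j, N−2−j, i, N−2−i` are `≥ i`
and `r_j − r_i ≤ 4 Σ_{k ≥ i} a_k =: s_i → 0`: the registered stub `stub_inwardOrdering` holds VERBATIM with `N₀ = 0`,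
`i₀ = 0`. The item's profile `τ` (quotients based at `T`) is identified with the stub's `θ` by the landed `eq_of_tendsto_sub_div`.
[folklore] -/
theorem stub_inwardOrdering_of_localFourierLaw :
    Summit.AtomisticToContinuum.FouriersLaw.Theses.SpatialCentreManifold.LocalFourierLaw → ∀ ω₂ lam β γ : ℝ,
    0 < ω₂ → 0 < lam → 0 < β → 0 < γ → (∀ (N : ℕ) (T_L T_R : ℝ), 0 < T_L → 0 < T_R → ∀ μ ν :
    MeasureTheory.Measure (Literature.MathematicalPhysics.KineticTheory.HeatConduction.PhaseSpace N),
    (Literature.MathematicalPhysics.KineticTheory.HeatConduction.pinnedChain ω₂ lam β γ).IsSteadyState N T_L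
    T_R μ → (Literature.MathematicalPhysics.KineticTheory.HeatConduction.pinnedChain ω₂ lam β
    γ).IsSteadyState N T_L T_R ν → μ = ν) → ∀ μ : (N : ℕ) → ℝ → ℝ → MeasureTheory.Measure
    (Literature.MathematicalPhysics.KineticTheory.HeatConduction.PhaseSpace N), (∀ (N : ℕ) (T_L T_R : ℝ), 0
    < T_L → 0 < T_R → (Literature.MathematicalPhysics.KineticTheory.HeatConduction.pinnedChain ω₂ lam β
    γ).IsSteadyState N T_L T_R (μ N T_L T_R)) → ∀ T : ℝ, 0 < T → ∃ N₀ i₀ : ℕ, ∃ s : ℕ → ℝ, Filter.Tendsto s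
    Filter.atTop (nhds 0) ∧ ∀ (N : ℕ) (θ : ℕ → ℝ) (d : ℝ), N₀ ≤ N → (∀ i : Fin N, Filter.Tendsto (fun δ : ℝ
    => ((∫ x, (x.2 i) ^ 2 ∂(μ N (T + δ / 2) (T - δ / 2))) - ∫ x, (x.2 i) ^ 2 ∂(μ N T T)) / δ) (nhdsWithin 0
    {(0 : ℝ)}ᶜ) (nhds (θ i))) → Filter.Tendsto (fun δ : ℝ =>
    (Literature.MathematicalPhysics.KineticTheory.HeatConduction.pinnedChain ω₂ lam β γ).totalCurrent (μ N
    (T + δ / 2) (T - δ / 2)) / δ) (nhdsWithin 0 {(0 : ℝ)}ᶜ) (nhds d) → 0 < d → ∀ i j : ℕ, i₀ ≤ i → i ≤ j → 2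
    * j + 2 ≤ N → (θ j - θ (j + 1)) * (((N : ℝ) - 1) / d) ≤ (θ i - θ (i + 1)) * (((N : ℝ) - 1) / d) + s i := by
  intro hLF ω₂ lam β γ hω hl hβ hγ hU μ hμ T hT
  obtain ⟨r, hr, a, ha0, haS, hfam⟩ := hLF ω₂ lam β γ hω hl hβ hγ hU T hT
  have hfamμ := hfam μ hμ
  -- tail sums of the summable envelope
  set tl : ℕ → ℝ := fun i => ∑' m, a (m + i) with htl
  have htail : ∀ i k : ℕ, i ≤ k → a k ≤ tl i := by
    intro i k hik
    have hsum : Summable fun m => a (m + i) := (summable_nat_add_iff i).2 haS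
    obtain ⟨m, rfl⟩ : ∃ m, k = m + i := ⟨k - i, by omega⟩
    exact hsum.le_tsum m (fun n _ => ha0 _)
  refine ⟨0, 0, fun i => 4 * tl i, ?_, ?_⟩
  · have h0 : Tendsto tl atTop (𝓝 0) := tendsto_sum_nat_add a
    simpa using h0.const_mul (4 : ℝ)
  intro N θ d _ hθ hd hdpos i j _ hij hjN
  obtain ⟨ι, τ, hι, hτ, hbond⟩ := hfamμ N
  have hN1 : (0 : ℝ) < (N : ℝ) - 1 := by
    have : (2 : ℝ) ≤ (N : ℝ) := by exact_mod_cast (show 2 ≤ N by omega)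
    linarith
  have hdι : d = ((N : ℝ) - 1) * ι := tendsto_nhds_unique hd hι
  have hιpos : 0 < ι := by
    by_contra h
    have : ((N : ℝ) - 1) * ι ≤ 0 := mul_nonpos_iff.2 (Or.inl ⟨hN1.le, not_lt.mp h⟩)
    linarith
  have hτθ : ∀ k : Fin N, τ k = θ k := fun k => (eq_of_tendsto_sub_div (hτ k) (hθ k)).2
  -- local resistance of bond `b` is within `a_b + a_{N-2-b}` of `r`
  have hloc : ∀ b : ℕ, ∀ hb : b + 1 < N,
      |(θ b - θ (b + 1)) * (((N : ℝ) - 1) / d) - r| ≤ a b + a (N - 2 - b) := by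
    intro b hb
    have h := hbond ⟨b, by omega⟩ ⟨b + 1, hb⟩ rfl
    rw [hτθ, hτθ] at h
    have h' : |θ (b + 1) - θ b + r * ι| ≤ |ι| * (a b + a (N - 1 - (b + 1))) := h
    rw [abs_of_pos hιpos, show N - 1 - (b + 1) = N - 2 - b by omega] at h'
    have heq : (θ b - θ (b + 1)) * (((N : ℝ) - 1) / d) - r = -(θ (b + 1) - θ b + r * ι) / ι := by
      rw [hdι]; field_simp; ring
    rw [heq, abs_div, abs_neg, abs_of_pos hιpos, div_le_iff₀ hιpos]
    linarith
  have hj := hloc j (by omega)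
  have hi := hloc i (by omega)
  have h1 := htail i j hij
  have h2 := htail i (N - 2 - j) (by omega)
  have h3 := htail i i le_rfl
  have h4 := htail i (N - 2 - i) (by omega)
  have hj' := (abs_le.mp hj).2
  have hi' := (abs_le.mp hi).1
  show (θ j - θ (j + 1)) * (((N : ℝ) - 1) / d) ≤ (θ i - θ (i + 1)) * (((N : ℝ) - 1) / d) + 4 * tl i
  linarith

end Summit.AtomisticToContinuum.FouriersLaw.Cruxes.BoundedResponseConverges.ComonotoneLocalResistance.Stubs

end
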